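import Mathlib
import HarnessLib

/-!
# Cusp widths and the Wohlfahrt level of a subgroup of `SL(2, ℤ)`

K. Wohlfahrt, *An extension of F. Klein's level concept*, Illinois J. Math. 8 (1964), 529–535,
§1, defines the (general) *level* of a subgroup `Γ` of finite index in the modular group as the
least common multiple of its cusp amplitudes (widths), and proves (Theorem 2, crediting Fricke) that
for congruence subgroups it agrees with Klein's level: `Γ ⊇ Γ(level)`. This is the notion used by
F. Calegari, V. Dimitrov, Y. Tang, *The unbounded denominators conjecture*, J. Amer. Math. Soc. 38
(2025), §4.1, Definition 4.1.1 (arXiv v1: Definition 17), verbatim: "The level `L(G)` of `G` is the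
lowest common multiple of all the cusp widths of `G`", the width of the cusp `ζ = M∞`
(`M ∈ SL₂(ℤ)`) of a finite-index `G` being "the minimal positive integer `m` such that
`± M Uᵐ M⁻¹ ∈ G`", `U = T = [1 1; 0 1]` (loc. cit.; CDT "typically only consider groups containing
`E = ⟨-I⟩`").

## Rendering

We work with subgroups `Γ ≤ SL(2, ℤ)` (Mathlib's setting for `CongruenceSubgroup.Gamma` and
`ModularForm` levels) and define, sign-free,

* `cuspWidth Γ g` — the least `m > 0` with `g Tᵐ g⁻¹ ∈ Γ` (`0` if there is none), the width of
  the cusp `g ∞`;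
* `wohlfahrtLevel Γ` — the least `N > 0` with `g Tᴺ g⁻¹ ∈ Γ` for every `g ∈ SL(2, ℤ)` (`0` if
  there is none).

For `Γ ∋ -1` (CDT's standing assumption `E ⊂ G`) these are literally CDT's width and level; in
general they are CDT's width and level of `⟨Γ, -1⟩ ∩ …` taken without the sign, i.e. the width of an
irregular cusp is counted twice — the convention of Mathlib's `Subgroup.strictPeriods` /
`strictWidthInfty` (as opposed to `Subgroup.periods` / `widthInfty`), to which `cuspWidth Γ 1` is
compared in `T_pow_mem_iff_natCast_mem_strictPeriods`.
That the level so defined IS the least common multiple of the widths is the content of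
`wohlfahrtLevel_dvd_iff_forall_cuspWidth_dvd` (for `Γ` of finite index every cusp has a positive
width, `cuspWidth_pos`, and `N` is a common period iff every width divides `N`,
`cuspWidth_dvd_iff`).
Wohlfahrt's Theorem 2 in this language, and CDT's Lemmas 4.1.2, 4.1.3, 4.1.5 on the level of
`G ∩ H`, of the normal core and of `diag(p,1)⁻¹ H diag(p,1) ∩ SL₂(ℤ)`, are in
`Literature/NumberTheory/Automorphic/UnboundedDenominatorsProofs.lean`.

## References

* [Wohlfahrt1964] K. Wohlfahrt, An extension of F. Klein's level concept, Illinois J. Math. 8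
  (1964), 529–535, §1 and Theorems 1–2.
* [CalegariDimitrovTang2025] F. Calegari, V. Dimitrov, Y. Tang, The unbounded denominators
  conjecture, J. Amer. Math. Soc. 38 (2025), 627–702, §4.1, Definition 4.1.1 (arXiv:2109.09040v1:
  Definition 17).
-/

namespace Literature.NumberTheory.Automorphic

open scoped MatrixGroups
open Matrix.SpecialLinearGroup ModularGroup

/-! ### A generic lemma: the least positive element of a numerical "subgroup" divides the others -/

/-- If a predicate on `ℕ` holds at `0`, is closed under addition and under subtraction of a smaller
element, and holds at some positive integer, then it holds at `m` iff its least positive witness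
divides `m` (Euclidean division). [folklore] -/
private lemma sInf_dvd_iff_of_closed {P : ℕ → Prop} (h0 : P 0)
    (hadd : ∀ a b, P a → P b → P (a + b)) (hsub : ∀ a b, b ≤ a → P a → P b → P (a - b))
    (hS : ∃ m, 0 < m ∧ P m) (m : ℕ) : sInf {m : ℕ | 0 < m ∧ P m} ∣ m ↔ P m := by
  set w := sInf {m : ℕ | 0 < m ∧ P m} with hw
  obtain ⟨hw0, hwP⟩ : 0 < w ∧ P w := Nat.sInf_mem (s := {m : ℕ | 0 < m ∧ P m}) hS
  have hmul : ∀ k : ℕ, P (w * k) := fun k ↦ by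
    induction k with
    | zero => simpa using h0
    | succ k ih => simpa [mul_add] using hadd _ _ ih hwP
  constructor
  · rintro ⟨k, rfl⟩
    exact hmul k
  · intro hm
    have hr : P (m % w) := by
      have e : m % w = m - w * (m / w) := eq_tsub_of_add_eq (by rw [add_comm, Nat.div_add_mod])
      rw [e]
      exact hsub _ _ (Nat.mul_div_le m w) hm (hmul _)
    by_contra hndvd
    have hr0 : 0 < m % w := Nat.pos_of_ne_zero fun h ↦ hndvd (Nat.dvd_of_mod_eq_zero h)
    have hle : w ≤ m % w := Nat.sInf_le ⟨hr0, hr⟩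
    exact absurd (Nat.mod_lt m hw0) (not_lt.mpr hle)

/-! ### Cusp widths -/

/-- The **width of the cusp `g ∞`** of `Γ ≤ SL(2, ℤ)` (`g ∈ SL(2, ℤ)`): the least positive integer
`m` with `g Tᵐ g⁻¹ ∈ Γ`, and `0` if there is none (there always is one when `Γ` has finite index,
`cuspWidth_pos`). For `Γ ∋ -1` this is the cusp width of CDT §4.1 ("the minimal positive integer
`m` such that `± M Uᵐ M⁻¹ ∈ G`") and Wohlfahrt's cusp amplitude; without `-1 ∈ Γ` it is the
sign-free ("strict") variant, cf. Mathlib's `Subgroup.strictPeriods`.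
[cite: CalegariDimitrovTang2025, §4.1 (Definition 4.1.1; arXiv v1 Definition 17)]
[cite: Wohlfahrt1964, §1] -/
noncomputable def cuspWidth (Γ : Subgroup SL(2, ℤ)) (g : SL(2, ℤ)) : ℕ :=
  sInf {m : ℕ | 0 < m ∧ g * T ^ m * g⁻¹ ∈ Γ}

/-- The **Wohlfahrt level** of `Γ ≤ SL(2, ℤ)`: the least positive integer `N` such that
`g Tᴺ g⁻¹ ∈ Γ` for every `g ∈ SL(2, ℤ)`, and `0` if there is none (there is one when `Γ` has finite
index, `wohlfahrtLevel_pos`). It is the least common multiple of the cusp widths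
(`wohlfahrtLevel_dvd_iff_forall_cuspWidth_dvd`), which is the printed definition: "The level `L(G)`
of `G` is the lowest common multiple of all the cusp widths of `G`" (for `Γ ∋ -1` literally; in
general in the sign-free variant, as for `cuspWidth`).
[cite: CalegariDimitrovTang2025, Definition 4.1.1 (arXiv v1: Definition 17)]
[cite: Wohlfahrt1964, §1 ("general level")] -/
noncomputable def wohlfahrtLevel (Γ : Subgroup SL(2, ℤ)) : ℕ :=
  sInf {N : ℕ | 0 < N ∧ ∀ g : SL(2, ℤ), g * T ^ N * g⁻¹ ∈ Γ}

variable (Γ : Subgroup SL(2, ℤ))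

/-- Unfolding lemma for `cuspWidth`. [folklore] -/
theorem cuspWidth_def (g : SL(2, ℤ)) :
    cuspWidth Γ g = sInf {m : ℕ | 0 < m ∧ g * T ^ m * g⁻¹ ∈ Γ} := rfl

/-- Unfolding lemma for `wohlfahrtLevel`. [folklore] -/
theorem wohlfahrtLevel_def :
    wohlfahrtLevel Γ = sInf {N : ℕ | 0 < N ∧ ∀ g : SL(2, ℤ), g * T ^ N * g⁻¹ ∈ Γ} := rfl

/-- In a subgroup of finite index every cusp has a period: some `g Tᵐ g⁻¹`, `0 < m ≤ [SL₂(ℤ) : Γ]`,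
lies in `Γ` ("`M Uᵐ M⁻¹ = (M U M⁻¹)ᵐ ∈ G` for some `m` because `G` has finite index", CDT §4.1).
[cite: CalegariDimitrovTang2025, §4.1] -/
theorem exists_conj_T_pow_mem [Γ.FiniteIndex] (g : SL(2, ℤ)) :
    ∃ m : ℕ, 0 < m ∧ m ≤ Γ.index ∧ g * T ^ m * g⁻¹ ∈ Γ := by
  obtain ⟨m, hm0, hmi, hm⟩ :=
    Γ.exists_pow_mem_of_index_ne_zero Subgroup.FiniteIndex.index_ne_zero (g * T * g⁻¹)
  exact ⟨m, hm0, hmi, by simpa only [conj_pow] using hm⟩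

/-- **The cusp width divides exactly the periods**: for `Γ` of finite index and `m : ℕ`,
`cuspWidth Γ g ∣ m ↔ g Tᵐ g⁻¹ ∈ Γ` (the periods of the cusp `g∞` form the subgroup of `ℤ`
generated by the width). [folklore] -/
theorem cuspWidth_dvd_iff [Γ.FiniteIndex] (g : SL(2, ℤ)) (m : ℕ) :
    cuspWidth Γ g ∣ m ↔ g * T ^ m * g⁻¹ ∈ Γ := by
  refine sInf_dvd_iff_of_closed (P := fun m ↦ g * T ^ m * g⁻¹ ∈ Γ) (by simp)
    (fun a b ha hb ↦ ?_) (fun a b hba ha hb ↦ ?_) ?_ m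
  · simpa only [pow_add, conj_mul] using Γ.mul_mem ha hb
  · have e : T ^ (a - b) = T ^ a * (T ^ b)⁻¹ := pow_sub _ hba
    simpa only [e, conj_mul, conj_inv] using Γ.mul_mem ha (Γ.inv_mem hb)
  · obtain ⟨m, hm0, -, hm⟩ := exists_conj_T_pow_mem Γ g
    exact ⟨m, hm0, hm⟩

/-- The width is a period: `g T^{cuspWidth Γ g} g⁻¹ ∈ Γ`. [folklore] -/
theorem conj_T_pow_cuspWidth_mem [Γ.FiniteIndex] (g : SL(2, ℤ)) :
    g * T ^ cuspWidth Γ g * g⁻¹ ∈ Γ :=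
  (cuspWidth_dvd_iff Γ g _).mp dvd_rfl

/-- Cusp widths of a finite-index subgroup are positive (and at most the index). [folklore] -/
theorem cuspWidth_pos [Γ.FiniteIndex] (g : SL(2, ℤ)) : 0 < cuspWidth Γ g := by
  obtain ⟨m, hm0, -, hm⟩ := exists_conj_T_pow_mem Γ g
  exact Nat.pos_of_ne_zero fun h ↦ by
    have := (cuspWidth_dvd_iff Γ g m).mpr hm
    rw [h, zero_dvd_iff] at this
    omega

/-- Cusp widths of a finite-index subgroup are at most the index. [folklore] -/
theorem cuspWidth_le_index [Γ.FiniteIndex] (g : SL(2, ℤ)) : cuspWidth Γ g ≤ Γ.index := by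
  obtain ⟨m, hm0, hmi, hm⟩ := exists_conj_T_pow_mem Γ g
  exact (Nat.le_of_dvd hm0 ((cuspWidth_dvd_iff Γ g m).mpr hm)).trans hmi

/-- The width of the cusp `g ∞` only depends on the cusp: right multiplication of `g` by a power of
`T` (which fixes `∞`) does not change it. [folklore] -/
theorem cuspWidth_mul_T_zpow [Γ.FiniteIndex] (g : SL(2, ℤ)) (k : ℤ) :
    cuspWidth Γ (g * T ^ k) = cuspWidth Γ g := by
  refine Nat.dvd_antisymm ?_ ?_ <;> rw [cuspWidth_dvd_iff] <;>
    [have h := conj_T_pow_cuspWidth_mem Γ g; have h := conj_T_pow_cuspWidth_mem Γ (g * T ^ k)] <;>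
    · convert h using 1
      group

/-- The width of the cusp `g ∞` only depends on its `Γ`-orbit: left multiplication of `g` by an
element of `Γ` does not change it ("the cusp width only depends on the orbit of the cusp under
`G`", CDT §4.1). [cite: CalegariDimitrovTang2025, §4.1] -/
theorem cuspWidth_mul_of_mem [Γ.FiniteIndex] {γ : SL(2, ℤ)} (hγ : γ ∈ Γ) (g : SL(2, ℤ)) :
    cuspWidth Γ (γ * g) = cuspWidth Γ g := by
  have key : ∀ m : ℕ, γ * g * T ^ m * (γ * g)⁻¹ ∈ Γ ↔ g * T ^ m * g⁻¹ ∈ Γ := fun m ↦ by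
    rw [show γ * g * T ^ m * (γ * g)⁻¹ = γ * (g * T ^ m * g⁻¹) * γ⁻¹ by group]
    refine ⟨fun h ↦ ?_, fun h ↦ Γ.mul_mem (Γ.mul_mem hγ h) (Γ.inv_mem hγ)⟩
    rw [show g * T ^ m * g⁻¹ = γ⁻¹ * (γ * (g * T ^ m * g⁻¹) * γ⁻¹) * γ by group]
    exact Γ.mul_mem (Γ.mul_mem (Γ.inv_mem hγ) h) hγ
  refine Nat.dvd_antisymm ?_ ?_ <;> rw [cuspWidth_dvd_iff]
  · exact (key _).mpr (conj_T_pow_cuspWidth_mem Γ g)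
  · exact (key _).mp (conj_T_pow_cuspWidth_mem Γ (γ * g))

/-! ### The Wohlfahrt level -/

/-- A finite-index subgroup has a common period at all cusps: `g Tᴺ g⁻¹ ∈ Γ` for all `g`, with
`N = [SL₂(ℤ) : Γ]!`. [folklore] -/
theorem conj_T_pow_factorial_index_mem [Γ.FiniteIndex] (g : SL(2, ℤ)) :
    g * T ^ (Γ.index).factorial * g⁻¹ ∈ Γ := by
  obtain ⟨m, hm0, hmi, hm⟩ := exists_conj_T_pow_mem Γ g
  obtain ⟨k, hk⟩ := Nat.dvd_factorial hm0 hmi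
  rw [hk, pow_mul, ← conj_pow]
  exact Γ.pow_mem hm k

/-- **The Wohlfahrt level divides exactly the common periods**: for `Γ` of finite index and
`N : ℕ`, `wohlfahrtLevel Γ ∣ N ↔ ∀ g, g Tᴺ g⁻¹ ∈ Γ`. In CDT's words: the level divides `N` iff
every cusp width divides `N` (`wohlfahrtLevel_dvd_iff_forall_cuspWidth_dvd`); in particular the
hypothesis "every conjugate of `Tᴺ` lies in `Γ`" used in
`Literature/NumberTheory/Automorphic/UnboundedDenominatorsProofs.lean` is "`L(Γ) ∣ N`".
[folklore] -/
theorem wohlfahrtLevel_dvd_iff [Γ.FiniteIndex] (N : ℕ) :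
    wohlfahrtLevel Γ ∣ N ↔ ∀ g : SL(2, ℤ), g * T ^ N * g⁻¹ ∈ Γ := by
  refine sInf_dvd_iff_of_closed (P := fun N ↦ ∀ g : SL(2, ℤ), g * T ^ N * g⁻¹ ∈ Γ)
    (fun g ↦ by simp) (fun a b ha hb g ↦ ?_) (fun a b hba ha hb g ↦ ?_) ?_ N
  · simpa only [pow_add, conj_mul] using Γ.mul_mem (ha g) (hb g)
  · have e : T ^ (a - b) = T ^ a * (T ^ b)⁻¹ := pow_sub _ hba
    simpa only [e, conj_mul, conj_inv] using Γ.mul_mem (ha g) (Γ.inv_mem (hb g))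
  · exact ⟨_, Nat.factorial_pos _, conj_T_pow_factorial_index_mem Γ⟩

/-- The level is a common period: `g T^{L(Γ)} g⁻¹ ∈ Γ` for every `g`. [folklore] -/
theorem conj_T_pow_wohlfahrtLevel_mem [Γ.FiniteIndex] (g : SL(2, ℤ)) :
    g * T ^ wohlfahrtLevel Γ * g⁻¹ ∈ Γ :=
  (wohlfahrtLevel_dvd_iff Γ _).mp dvd_rfl g

/-- `T^{L(Γ)} ∈ Γ`. [folklore] -/
theorem T_pow_wohlfahrtLevel_mem [Γ.FiniteIndex] : T ^ wohlfahrtLevel Γ ∈ Γ := by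
  simpa using conj_T_pow_wohlfahrtLevel_mem Γ 1

/-- The Wohlfahrt level of a finite-index subgroup is positive. [folklore] -/
theorem wohlfahrtLevel_pos [Γ.FiniteIndex] : 0 < wohlfahrtLevel Γ := by
  refine Nat.pos_of_ne_zero fun h ↦ ?_
  have := (wohlfahrtLevel_dvd_iff Γ (Γ.index).factorial).mpr (conj_T_pow_factorial_index_mem Γ)
  rw [h, zero_dvd_iff] at this
  exact (Nat.factorial_pos _).ne' this

/-- The Wohlfahrt level divides `[SL₂(ℤ) : Γ]!`. [folklore] -/
theorem wohlfahrtLevel_dvd_factorial_index [Γ.FiniteIndex] :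
    wohlfahrtLevel Γ ∣ (Γ.index).factorial :=
  (wohlfahrtLevel_dvd_iff Γ _).mpr (conj_T_pow_factorial_index_mem Γ)

/-- Every cusp width divides the Wohlfahrt level. [folklore] -/
theorem cuspWidth_dvd_wohlfahrtLevel [Γ.FiniteIndex] (g : SL(2, ℤ)) :
    cuspWidth Γ g ∣ wohlfahrtLevel Γ :=
  (cuspWidth_dvd_iff Γ g _).mpr (conj_T_pow_wohlfahrtLevel_mem Γ g)

/-- **The Wohlfahrt level is the least common multiple of the cusp widths** (the printed definition,
CDT Definition 4.1.1 / Wohlfahrt §1), in divisibility form: `L(Γ) ∣ N` iff every cusp width divides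
`N`. [cite: CalegariDimitrovTang2025, Definition 4.1.1 (arXiv v1: Definition 17)] -/
theorem wohlfahrtLevel_dvd_iff_forall_cuspWidth_dvd [Γ.FiniteIndex] (N : ℕ) :
    wohlfahrtLevel Γ ∣ N ↔ ∀ g : SL(2, ℤ), cuspWidth Γ g ∣ N := by
  simp only [wohlfahrtLevel_dvd_iff, cuspWidth_dvd_iff]

/-- Monotonicity: a larger subgroup has a smaller (dividing) level. [folklore] -/
theorem wohlfahrtLevel_dvd_of_le {Γ Γ' : Subgroup SL(2, ℤ)} [Γ.FiniteIndex] [Γ'.FiniteIndex]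
    (h : Γ ≤ Γ') : wohlfahrtLevel Γ' ∣ wohlfahrtLevel Γ :=
  (wohlfahrtLevel_dvd_iff Γ' _).mpr fun g ↦ h (conj_T_pow_wohlfahrtLevel_mem Γ g)

/-- The principal congruence subgroup `Γ(N)`, `N ≠ 0`, has Wohlfahrt level dividing `N` (in fact
equal to `N`). [folklore] -/
theorem wohlfahrtLevel_Gamma_dvd (N : ℕ) [NeZero N] :
    wohlfahrtLevel (CongruenceSubgroup.Gamma N) ∣ N := by
  refine (wohlfahrtLevel_dvd_iff _ N).mpr fun g ↦ ?_
  have hT : T ^ N ∈ CongruenceSubgroup.Gamma N := by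
    have h := CongruenceSubgroup.ModularGroup_T_pow_mem_Gamma N N dvd_rfl
    rwa [Int.natAbs_natCast, zpow_natCast] at h
  exact (CongruenceSubgroup.Gamma_normal N).conj_mem _ hT g

/-! ### Comparison with Mathlib's strict periods at `∞` -/

/-- `Tʰ ∈ Γ` iff `h` is a strict period at `∞` of the image of `Γ` in `GL(2, ℝ)` (Mathlib's
`Subgroup.strictPeriods`, the hypothesis format of `ModularForm` `q`-expansions); hence
`cuspWidth Γ 1 ∣ h ↔ (h : ℝ) ∈ strictPeriods Γ` for `Γ` of finite index. [folklore] -/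
theorem T_pow_mem_iff_natCast_mem_strictPeriods (h : ℕ) :
    T ^ h ∈ Γ ↔ ((h : ℝ)) ∈ (Γ : Subgroup (GL (Fin 2) ℝ)).strictPeriods := by
  have base : (mapGL ℝ T : GL (Fin 2) ℝ) = Matrix.GeneralLinearGroup.upperRightHom (1 : ℝ) := by
    ext i j
    fin_cases i <;> fin_cases j <;> simp [ModularGroup.coe_T]
  have key : (mapGL ℝ (T ^ h) : GL (Fin 2) ℝ) =
      Matrix.GeneralLinearGroup.upperRightHom ((h : ℝ)) := by
    rw [map_pow, base, ← AddChar.map_nsmul_eq_pow, nsmul_one]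
  rw [Subgroup.mem_strictPeriods_iff, ← key]
  exact (Subgroup.mem_map_iff_mem mapGL_injective).symm

/-- For `Γ` of finite index: `cuspWidth Γ 1 ∣ h ↔ (h : ℝ) ∈ strictPeriods Γ`. [folklore] -/
theorem cuspWidth_one_dvd_iff_mem_strictPeriods [Γ.FiniteIndex] (h : ℕ) :
    cuspWidth Γ 1 ∣ h ↔ ((h : ℝ)) ∈ (Γ : Subgroup (GL (Fin 2) ℝ)).strictPeriods := by
  rw [cuspWidth_dvd_iff, ← T_pow_mem_iff_natCast_mem_strictPeriods]
  simp

end Literature.NumberTheory.Automorphic
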